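import Literature.NumberTheory.EllipticCurves.ModularCurve
import Literature.NumberTheory.EllipticCurves.QuadraticTwist
import Literature.NumberTheory.EllipticCurves.Isogeny
import Literature.NumberTheory.EllipticCurves.GlobalMinimalModel
import Literature.NumberTheory.DiophantineGeometry.Conductor
import HarnessLib
import HarnessLib.Audit.Tags

/-!
# Candidate E-imc-8: χ₋₄-FLATNESS of optimal degrees and minimal discriminants at `p = 2` (`MinusOneTwistFlat`)
# — cell `bsd-f2-manin` (D-0131 (3) frontier: the Manin constant at additive primes). `@[conjecture]`
# leaf (NOTHING asserted; definition only; proved edge to E-imc-4 (i) at `(2, −1)` in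
# `RamifiedTwistExactEdges.lean`).

HONEST FRAMING. LENS = Iwasawa-main-conjecture / Λ-adic integrality read as RAMIFIED-QUADRATIC-TWIST
laws at the additive prime (planner-of-record `bsd-f2-manin-imc`, HOME
`run/shared/lean/pub/bsd-f2-manin/MEMO-imc.md` §9 (g1); Prop VERBATIM from HOME/imc/Sketch-imc-g1.lean
(sha16 eda08fcdae877d26) with `IsLatticeOptimal` inlined as the lattice clause `Λ_W = c·Λ_f`). The pair:
`W`, `W′` globally minimal models of two `X₀(N)`-optimal curves (data `D`, `D′` at the CONDUCTOR levels
with the lattice clauses — refuter-1 traps T1/T2/T3 on BOTH curves) of the SAME conductor `N` with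
`4 ∣ N`, whose classes differ by the twist by `−1` (CM and rational 2-isogenies allowed).

THIS ROW (E-imc-8, memo §9): the optimal degrees are EQUAL and so are the `2`-adic valuations of the
minimal discriminants. BC5 WITNESS: census v0 (HOME/imc/TWISTCENSUS-v0, N < 10⁵): 54 606 / 54 606 directed
rows (32 546 irreducible, 21 932 with a rational 2-isogeny, 128 CM), 0 exceptions. Refuter verdicts: REF1
**SURVIVES** 2026-08-27T15:40Z (HOME/REFUTER-ref1.md §R2.3: independent engine N < 5·10⁵, 0 violations /
297 203 directed rows (irreducible 192 614, 2-isogeny 103 620, CM 320 + 649); local lemma «χ₋₄ keeps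
v₂Δ_min iff f₂ stays ≥ 2» verified on all 24 711 curves with 4 ∣ N < 10⁴; scope note: same-conductor χ₋₄
pairs occur only at v₂(N) ≥ 5, so the binder `2² ∣ N` is wider than the data's habitat but load-bearing
as scope; IsLatticeOptimal ×2 load-bearing); REF2 (HOME/REFUTER-ref2.md §R2.19): degree clause
IN-PRINT-IMPLICIT for 16 ∣ N (`f ⊗ χ₋₄ = i·f|τ_{1/4}`, Atkin–Lehner 1970 / Lehner–Newman 1964:
τ_{1/h} normalises Γ₀(N) iff h ∣ 24, h² ∣ N), v₂Δ_min clause OPEN-shallow (not placed) — a theorem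
target as much as a law; typed as a leaf on the planner-of-record's ask T-imc-4.
-/

noncomputable section

open scoped MatrixGroups ModularForm

open CongruenceSubgroup WeierstrassCurve
  Literature.NumberTheory.EllipticCurves Literature.NumberTheory.EllipticCurves.ModularForms

namespace Summit.BirchSwinnertonDyer.Rank1Residual.ManinAdditive

/-- **Candidate E-imc-8 `MinusOneTwistFlat` (cell bsd-f2-manin; a LAW, NOT in print as a law for optimal
curves, nothing asserted):** for two `X₀(N)`-optimal curves `(W, D)`, `(W′, D′)` (globally minimal models,
data at the conductor levels with the lattice clauses `Λ = c·Λ_f`) of the same conductor `N` with `4 ∣ N`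
and `W′ ~ W ⊗ χ₋₁`: `deg φ_{D′} = deg φ_D` and `v₂ Δ_min(W′) = v₂ Δ_min(W)`.
[cite: Watkins2002, §2.1 p. 491 (shape only: the degree identity under quadratic twists; the flatness law
for OPTIMAL degrees and minimal discriminants under `χ₋₁` is NOT in print — cell bsd-f2-manin MEMO-imc.md
§9, E-imc-8)] -/
@[conjecture] def MinusOneTwistFlat : Prop :=
  ∀ (W W' : WeierstrassCurve ℚ) [W.IsElliptic] [W.IsGloballyMinimal] [W'.IsElliptic]
    [W'.IsGloballyMinimal] [NeZero (W.conductorNorm ℤ)] [NeZero (W'.conductorNorm ℤ)]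
    (D : ModularParametrizationData W (W.conductorNorm ℤ))
    (D' : ModularParametrizationData W' (W'.conductorNorm ℤ)),
    (∀ z ∈ D.L.lattice, ∃ w ∈ periodLattice D.f, z = D.c * w) →
    (∀ z ∈ D'.L.lattice, ∃ w ∈ periodLattice D'.f, z = D'.c * w) →
    2 ^ 2 ∣ W.conductorNorm ℤ → W'.conductorNorm ℤ = W.conductorNorm ℤ →
    IsIsogenous (W.quadraticTwist ((-1 : ℤ) : ℚ)) W' →
    D'.modularDegree = D.modularDegree ∧
      padicValInt 2 W'.minimalDiscriminantInt = padicValInt 2 W.minimalDiscriminantInt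

end Summit.BirchSwinnertonDyer.Rank1Residual.ManinAdditive

end
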